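import Literature.NumberTheory.EllipticCurves.Castella2018.ErratumHidaMembersFrames
import HarnessLib

/-!
# Hida members `g_m` with Σ-imprimitive anticyclotomic `p`-adic `L`-functions for the SAME CM periods, congruent to
# `L^Σ_p(f)` mod `p^m` — the ANALYTIC half of the erratum chain READ AT AN ODD PRIME `p` from Castella, J. Inst. Math.
# Jussieu 19 (2020), §2 (Def. 2.10, Thm. 2.11: "let `p` be an odd prime not dividing `N`") and Skinner 2016 §2.6 (`p ≥ 3`)

Topic `Literature/NumberTheory/EllipticCurves`, cluster `Castella2018` (sibling of `ErratumHidaMembersFrames.lean`, fact F3♯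
`erratum_exists_frames_members_sigma_congruence`, whose binder `3 < p` and non-split witness `q` come from the erratum's Thm. 1.1
and footnote 1). Cell `pub/bsd-wall`, literature-typer seat `bsd-wall-utd-ty1` (gen 7), `--supports` stmt-BirchSwinnertonDyer-23594;
the CONSUMER is the ♭B′ column of the route `UniversalToricDescent` at `p = 3` (crux stmt-…-27401 `TwinWanFrameAtThreeMultTresT`,
line `membertower` v9/v10 of the lead utd-p2 g13: stub `stub_memberInclusionMultUnitCong` = K1 + K2′/K2″, with K2″ = "the last clause
(c) of F3♯ with `p = 3` in `𝓞_{ℂ₃}⟦T⟧`", bus utd-p2-w2 g4 2026-08-28T12:04Z). ONE named `Prop` (D-0014: +1 unproved; nothing asserted,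
no `_holds`, no instance, no notation); nothing about `p`-adic `L`-functions is constructed here. HONEST FRAMING: BSD is not proved by
typing this; the crux's research content (K1, the one-sided rational member inclusion at `p = 3`) is untouched.

## Why this file exists (the print audit behind it; texts read 2026-08-28, locators = `paper:arxiv-1410.6591` TeX pages)

The lead's memo MEMBER-INCLUSION-AT3-g12 §1 classified (c) at `p = 3` as a PORT because "Castella, JIMJ 19 (2020) §Intro standing «Let
`p ≥ 5`»" [p0003 L3]. That «`p ≥ 5`» governs the paper's HEEGNER-POINT theorems (§3–§5: Howard's big Heegner points [p0010 L1–L9], the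
big regulator and Thm. 4.4 [p0013 L34]). The CONSTRUCTION section — journal §2 = TeX §1 "Two-variable `p`-adic Rankin `L`-series" — has
its own standing: "Fix an integer `N ≥ 1`, and let `p` be an odd prime not dividing `N`" [p0005 L8]; "`K = ℚ(√−D)` an imaginary
quadratic field in which the prime `p` splits … we assume that `D` is odd, that `p` does not divide the class number of `K`, and that
there is an ideal `𝔑 ⊂ 𝒪` with `𝒪/𝔑 ≅ ℤ/Nℤ`" [p0005 L51–L56]; Def. 2.10 (= TeX Def. 1.3) "`𝓛_{𝔭,ξ}(𝐟)(ν, φ) := Σ_{[𝔞] ∈ Pic(𝒪)}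
ξ_νχ_ν(𝔞) · ∫_{ℤ_p^×} φ|[𝔞](z) μ_{d⁻¹𝐟_ν^{[p]}|[𝔞]}(z)` for all `ν ∈ 𝒳_arith(𝓡)` and `φ ∈ Hom_cts(Γ, 𝒲^×)`" [p0006 L60–L80]; **Thm.
2.11 (= TeX Thm. 1.4)** [p0006 L118 ff.]: "Let `ν ∈ 𝒳_arith(𝓡)` be an arithmetic prime of weight `k ≥ 2` and trivial nebentypus. (i)
If `φ` … unramified anticyclotomic … of infinity type `(−ℓ, ℓ)` with `ℓ > 0`, then `𝓛_{𝔭,ξ}(𝐟)(ν, φ̂)² = C(ν, ξ_νφ) · 𝓔_𝔭(ν, ξ_νφ)² ·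
𝓔*_𝔭(ν, ξ_νφ)² · Ω_p^{2k+4−4ℓ} · L(𝐟_ν, ξ_νφ, k/2)/Ω_∞^{2k+4−4ℓ}`, where … `𝓔_𝔭 = (1 − ν(𝐚_p)p^{−k/2} ξ_νφ(𝔭̄))`, `𝓔*_𝔭 = (1 −
p^{k/2−1}ν(𝐚_p)^{−1} ξ_νφ(𝔭̄))`, `Ω_p ∈ ℤ̂_p^{nr}` and `Ω_∞ ∈ ℂ^×` are periods of the curve `A`. (ii) If `ρ̄_𝐟|_{G_K}` is absolutely
irreducible, then the measure `𝓛_{𝔭,ξ}(𝐟)(ν, −)` is non-zero" — PROOF [p0007 L1–L40]: the displayed CM-point formula for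
`𝓛_{𝔭,ξ}(𝐟)(ν, φ̂)`, then "(i) follows from [BDP13], applied to `(f, χ) = (𝐟_ν, λ_ν)`; and (ii) follows from the nonvanishing result of
[Hsieh14]". No `p ≥ 5` occurs in §2 (grep of the whole TeX: «`p ≥ 5`» only p0003 L3; «odd prime» p0005 L8). Hence, at `p = 3` with
`3 ∤ M` (`M = N/3` the tame level), `3` split in `K`, `d_K` odd, `3 ∤ h_K`, Heegner ideal `𝔑` for `M`: every Hida member `g_m` (weight
`k_m > 2`, trivial nebentypus, `3`-old: an arithmetic prime `ν_{g_m}`) AND `f` itself (weight `2`, trivial nebentypus, `3`-new: an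
arithmetic prime `ν_f` of weight `2`; `𝓔*_𝔭(ν_f, φ) = 1 ∓ ξφ(𝔭̄)`, no identically vanishing factor) are covered by Thm. 2.11 VERBATIM,
with the SAME periods `(Ω_p, Ω_∞)` at every `ν`. Members exist at `p ≥ 3` (Skinner 2016 §2.6 (2-6-1), §3.1; tree
`Skinner2016.skinner2016_exists_hidaCongruentMember_three_le`).

WHAT IS NOT A PRINTED SENTENCE AT `p = 3` (flags below): (α) "`𝓛_{𝔭,𝛏}(𝐟) ∈ Λ_{𝓡,R₀} := Λ_𝓡 ⊗̂_{ℤ_p} R₀`" and the specialisation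
display (4.1) "`L^Σ_p(𝐟) mod ℘̃_φ = L^Σ_p(𝐟_φ)` for all `φ ∈ 𝒳^a_𝓡`" are sentences of [Castella2018] §4 (`paper:arxiv-1704.06608`
p0010 L90–L100, proof of Thm. 4.2: "the proof of [Cas20, Thm. 2.11] shows that `L_p(𝐟)` reduces to `L_p(𝐟_φ)` modulo `℘̃_φ`"), a
paper whose Thm. A is printed for `p > 3` [p0003 L13] — the element-hood itself is the construction of Def. 2.10 (the `𝓡`-adic measure
of the `𝓡`-adic form `d⁻¹𝐟^{[p]}` at ordinary CM points, values in `𝓡 ⊗̂ 𝒲`); (β) the identification at the weight-`2` `p`-NEW point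
(`φ_f(L_p(𝐟)) ~ L_p(f)`) is [Castella2018, p. 11 L9–11] + the erratum (flag `MF-sp-factor` of the sibling). So the congruence (c)
`(L^Σ_p(g_m)) + (p^m) = (L^Σ_p(f)) + (p^m)` at `p = 3` is the specialisation of ONE `𝓡 ⊗̂ R₀⟦Γ⟧`-valued measure at two arithmetic
primes congruent mod `p^m` (`φ_{k'} ≡ φ_0 (mod p^m)`, Skinner (2-6-1)) — bookkeeping over print, displayed in print only under `p > 3`.

## Transcription (tree vocabulary only; = the sibling F3♯ with EXACTLY these changes)

Binders of F3♯ with `3 < p` REPLACED by `p ≠ 2` ("odd prime", Cas20 §2; "`p ≥ 3`", Ski16) and WITHOUT the erratum's (iii)-witness `q`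
(a multiplicative prime non-split in `K` at which `E[p]` is ramified — it serves the erratum's SELMER side, Thm. 2.3 (iii), and is void
for the all-split `K` of the consumer). Conclusion of F3♯ WITHOUT the footnote-1 clause "`ρ̄_{g_m}` ramified at `q`" (the clause
"`ρ̄_{g_m}` irreducible" is kept: `T_{g_m}/p ≃ E[p]` irreducible); everything else — the `R₀`-frame of `f` [Cas18 Thm. 3.1 currency
`IsBDPLFunction`; at `p ∣ N` odd, the tree's frame predicate], the member `D : Skinner2016.HidaCongruentMember W p m` with `MF-compat`, the
rigidity clause at non-split `ℓ ∣ M` [FO12 L.2.14] (vacuous when every `ℓ ∣ M` splits), the Σ-imprimitive weight-`k_m` frame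
`IsBDPLFunctionWtSigmaInt … D.g … ΩK Ωp Q_m` for the SAME periods [Cas20 Thm. 2.11 + JSW17 §5.1], and (c) in `𝓞_{ℂ_p}⟦T⟧` — VERBATIM
as in F3♯ (same receptacle maps `a : R₀ ⊆ 𝓞_{ℂ_p}`, `j : ℤ_p → R₀`).

## Flags (nothing hidden; each makes the `Prop` WEAKER than or equal to the printed chain, or names a reading)

* `MF-odd-p` (NEW, the point of this file): the member frames and their interpolation are Cas20 Thm. 2.11, printed for ODD `p ∤ M`;
  the congruence display (c)/(4.1) and the element-hood sentence are printed in [Castella2018]/[Castella2018Erratum] under `p > 3` only —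
  at `p = 3` they are the specialisation bookkeeping of Def. 2.10's `𝓡`-adic measure (reading (α)/(β) above). A consumer at `p = 3`
  cites this flag.
* `MF-frame-f-at-p|N`: the frame of `f` (`IsBDPLFunction`, Cas18 Thm. 3.1 for `p ∥ N`) is part of the CONCLUSION as in F3♯; Cas18 prints
  it for `p > 3`; at `p = 3` it is Thm. 2.11 (i) at the weight-`2` arithmetic prime `ν_f` read through (β).
* Inherited from F3♯ verbatim: `MF-compat`, `MF-chain`, `MF-sp-factor`, `MF-receptacle`, `MF-sigma-interp`, `MF-periods`, `MF-own-ring`,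
  `MF-per-m`, `MF-A-side`.

## References

* [Castella2020JIMJ] §2: standing p0005 L8 / L51–L56 (TeX), Def. 2.10 (TeX Def. 1.3), Thm. 2.11 (TeX Thm. 1.4) with proof (TeX p0007).
* [Castella2018] Camb. J. Math. 6 (2018), Thm. 3.1, (3.1), §4 (Thm. 4.2 proof, (4.1), p. 11 L9–11). [Castella2018Erratum] proof of Thm.
  1.1 (a)(b)(c). [Skinner2016PacificMC] §2.6 (2-6-1), §3.1 (a)(b); tree `Skinner2016/HidaCongruentMembers.lean`.
  [FouquetOchiai2012] Lem. 2.14. [JetchevSkinnerWan2017] §5.1. [BertoliniDarmonPrasanna2013], [Hsieh2014] (inputs of the proof of Thm. 2.11).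
-/

noncomputable section

open scoped Classical

open PowerSeries WeierstrassCurve NumberField IsDedekindDomain Field
  Literature.NumberTheory.EllipticCurves Literature.NumberTheory.EllipticCurves.ModularForms
  Literature.NumberTheory.EllipticCurves.Rank1Residual Literature.NumberTheory.EllipticCurves.BigGaloisRep
  Literature.NumberTheory.EllipticCurves.GreenbergSelmer Literature.NumberTheory.GaloisRepresentations

namespace Literature.NumberTheory.EllipticCurves.Castella2018

/-- ⚠ RETURNED MISSTATED (refuter `bsd-vet-utdR2` g0, 2026-08-28): the erratum's print hypothesis (iii) is missing and the `Prop` is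
FALSE as stated (split multiplicative `ℓ ∣ M` not split in `K`; witness `39a1`, `p = 3`, `K = ℚ(√−143)`); NEVER cite it — use the
print-faithful re-type `castella2020_thm211_members_frames_sigma_congruence_odd_nonsplit` below (same text + (iii)).
**Castella, JIMJ 2020, Def. 2.10 + Thm. 2.11 (odd `p ∤ M`) with Skinner 2016 §2.6/§3.1 (`p ≥ 3`) — the published member data WITH
FRAMES, read at an ODD prime: the `R₀`-frame of `f`; for every `m ≥ 1` a Hida member `g_m` [Ski16 §2.6 (a)(b)] with `ρ̄_{g_m} ≃ E[p]`
irreducible and the rigid Steinberg sign at every `ℓ ∣ M` non-split in `K` [FO12 L.2.14]; and its Σ-imprimitive `p`-adic `L`-function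
`Q_m = L^Σ_p(g_m) ∈ 𝓞_{ℂ_p}⟦T⟧` for the SAME CM periods [Cas20 Thm. 2.11, "`p` an odd prime not dividing `N`"] with (c)
`(L^Σ_p(g_m)) + (p^m) = (L^Σ_p(f)) + (p^m)` (the specialisation of Cas20's two-variable measure at `ν_{g_m} ≡ ν_f (mod p^m)`; displayed
as [Cas18 (4.1)] / [erratum (c)] under `p > 3`: flag `MF-odd-p`).** = the sibling `erratum_exists_frames_members_sigma_congruence` with
`3 < p` replaced by `p ≠ 2` and without the non-split witness `q` (binders, transcription and all flags: module docstring). A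
conjunction of published results read at odd `p` (D-0014); nothing about `p`-adic `L`-functions is constructed here.
[cite: Castella2020JIMJ, §2 standing (arXiv TeX p. 5: "p an odd prime not dividing N"), Def. 2.10 and Thm. 2.11 (the two-variable `ℒ_{𝔭,ξ}(𝐟)` with fixed CM periods, every arithmetic prime of weight ≥ 2)]
[cite: Skinner2016PacificMC, §2.6 (2-6-1) and §3.1 (a)(b) (p. 192) (members, `p ≥ 3`)]
[cite: Castella2018, Thm. 3.1, (3.1) (p. 9), (4.1) and p. 11 L9–11 (frame of `f`; `L^Σ`; specialisation — printed for `p > 3`, flag `MF-odd-p`)]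
[cite: Castella2018Erratum, proof of Thm. 1.1 (a)(b)(c) (p. 4) (the chain, as assembled there for `p > 3`)]
[cite: FouquetOchiai2012, Lem. 2.14 (rigidity of automorphic types for the members)]
[cite: JetchevSkinnerWan2017, §5.1 (arXiv:1512.06894 tex p0022 L41–50) (Σ-imprimitive interpolation)] -/
def castella2020_thm211_members_frames_sigma_congruence_odd : Prop :=
  ∀ {p : ℕ} [Fact p.Prime] (ι : PadicAlgCl p ≃+* ℂ) (W : WeierstrassCurve ℚ) [W.IsElliptic]
    [W.IsGloballyMinimal] (K : Type) [Field K] [NumberField K]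
    (𝔭 : HeightOneSpectrum (𝓞 K)) (κ : ZpExtension K p) (γ : absoluteGaloisGroup K)
    [Fact (κ.IsTopGenerator γ)] {N : ℕ} [NeZero N] {f : CuspForm (CongruenceSubgroup.Gamma0 N) 2}
    (_ : IsNewformOf W f),
    -- `E/ℚ` of conductor `N`, multiplicative at the ODD prime `p` ("p an odd prime", Cas20 §2; "p ≥ 3", Ski16), `M = N/p ≥ 3`,
    -- `E[p]` irreducible
    W.conductorNorm ℤ = N → p ≠ 2 → Mult W p → 3 ≤ N / p → Irr W p →
    -- `K` imaginary quadratic, `d_K` odd [Cas20 §2.2], Heegner for `N`, `p = 𝔭𝔭̄` split, `𝔭` via `ι`, `p ∤ h_K` is in the frame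
    -- predicates' own standing (tree `IsBDPLFunction`); we keep F3♯'s binder list
    IsImaginaryQuadratic K → Odd (NumberField.discr K) → (∃ β : ℤ, (4 * N : ℤ) ∣ β ^ 2 - NumberField.discr K) →
    ((Ideal.span {(p : ℤ)}).primesOver (𝓞 K)).ncard = 2 →
    ((p : ℕ) : 𝓞 K) ∈ 𝔭.asIdeal →
    (∀ (w : InfinitePlace K) (x : 𝓞 K), x ∈ 𝔭.asIdeal ↔ ‖ι.symm (w.embedding (x : K))‖ < 1) →
    -- `Γ` THE anticyclotomic `ℤ_p`-extension
    κ.IsAnticyclotomic →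
    -- receptacle maps: `a : R₀ ⊆ 𝓞_{ℂ_p}` the inclusion, `j : ℤ_p → R₀` the structure map (characterised)
    ∀ (a : unrIntegers p →+* PadicComplexInt p) (j : ℤ_[p] →+* unrIntegers p),
      (∀ x : unrIntegers p, ((a x : PadicComplexInt p) : ℂ_[p]) = (x : ℂ_[p])) →
      (∀ x : ℤ_[p], ((j x : unrIntegers p) : ℂ_[p]) = algebraMap ℚ_[p] ℂ_[p] (x : ℚ_[p])) →
    -- THEN: an `R₀`-frame of `f` at `(ι, 𝔭)` …
    ∃ (ΩK : ℂ) (Ωp : (unrIntegers p)ˣ) (L : UnrSeries p),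
      ΩK ≠ 0 ∧ IsBDPLFunction ι 𝔭 κ γ f ΩK ((Ωp : unrIntegers p) : ℂ_[p]) L ∧
      -- … and for every `m ≥ 1` a member (a)+(b) with its printed properties and its Σ-imprimitive `p`-adic `L`-function
      ∀ m : ℕ, 1 ≤ m →
        ∃ (D : Skinner2016.HidaCongruentMember W p m) (Qm : PowerSeries (PadicComplexInt p)),
          -- the member's `p`-adic coefficient embedding IS the fixed `ı_p = ι⁻¹` on `ℚ(g_m) ⊂ ℂ` (flag `MF-compat`)
          (∀ x : coeffField D.g, ι (D.ι x) = (x : ℂ)) ∧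
          -- `ρ̄_{g_m} ≃ E[p]` is irreducible
          SkinnerUrban2014.IsResiduallyIrreducible D.Δ ∧
          -- rigidity of automorphic types [FO12 L.2.14]: `π(g_m)_ℓ` special ⊗ (`ℓ ↦ −ℓ^{k_m/2−1}`) at every `ℓ ∣ M` non-split in `K`
          (∀ ℓ : ℕ, ℓ.Prime → ℓ ∣ N / p → ((Ideal.span {(ℓ : ℤ)}).primesOver (𝓞 K)).ncard ≠ 2 →
            (UpperHalfPlane.qExpansion 1 ⇑D.g).coeff ℓ = -((ℓ : ℂ) ^ (D.k / 2 - 1).toNat)) ∧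
          -- `Q_m = L^Σ_p(g_m)`: the Σ-imprimitive frame of `g_m` for the SAME periods [Cas20 Thm. 2.11 (odd `p`), JSW17 §5.1]
          IsBDPLFunctionWtSigmaInt ι 𝔭 κ γ D.g (W.sigmaPlacesFinset p K) ΩK ((Ωp : unrIntegers p) : ℂ_[p]) Qm ∧
          -- (c): `(L^Σ_p(g_m), p^m) = (L^Σ_p(f), p^m)`, `L^Σ_p(f) = L_p(f)·P_Σ`, read in `𝓞_{ℂ_p}⟦T⟧` (flag `MF-odd-p`)
          Ideal.span {Qm} ⊔ Ideal.span {(PowerSeries.C (((p : ℕ) : PadicComplexInt p) ^ m))} =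
            Ideal.span {PowerSeries.map a (L * PowerSeries.map j (W.sigmaEulerElement p K κ))} ⊔
              Ideal.span {(PowerSeries.C (((p : ℕ) : PadicComplexInt p) ^ m))}

/-- The sibling fact F3♯ (`3 < p`, with the erratum's non-split witness `q`) IMPLIES nothing new here and conversely this odd-`p` reading
SPECIALISES to F3♯'s analytic clauses at `3 < p`: the odd-`p` statement yields, for `3 < p`, the frame of `f` and members with frames and
(c) (the clauses of F3♯ not involving `q`). Bookkeeping (`3 < p → p ≠ 2`), proved. [cite: Castella2018Erratum, proof of Thm. 1.1 (a)(b)(c) (p. 4)] -/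
theorem castella2020_thm211_members_frames_sigma_congruence_odd.of_three_lt
    (h : castella2020_thm211_members_frames_sigma_congruence_odd)
    {p : ℕ} [Fact p.Prime] (ι : PadicAlgCl p ≃+* ℂ) (W : WeierstrassCurve ℚ) [W.IsElliptic]
    [W.IsGloballyMinimal] (K : Type) [Field K] [NumberField K]
    (𝔭 : HeightOneSpectrum (𝓞 K)) (κ : ZpExtension K p) (γ : absoluteGaloisGroup K)
    [Fact (κ.IsTopGenerator γ)] {N : ℕ} [NeZero N] {f : CuspForm (CongruenceSubgroup.Gamma0 N) 2}
    (hf : IsNewformOf W f) (hN : W.conductorNorm ℤ = N) (hp : 3 < p) (hmult : Mult W p) (hM : 3 ≤ N / p) (hirr : Irr W p)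
    (hK : IsImaginaryQuadratic K) (hodd : Odd (NumberField.discr K)) (hβ : ∃ β : ℤ, (4 * N : ℤ) ∣ β ^ 2 - NumberField.discr K)
    (hsplit : ((Ideal.span {(p : ℤ)}).primesOver (𝓞 K)).ncard = 2) (h𝔭 : ((p : ℕ) : 𝓞 K) ∈ 𝔭.asIdeal)
    (hι : ∀ (w : InfinitePlace K) (x : 𝓞 K), x ∈ 𝔭.asIdeal ↔ ‖ι.symm (w.embedding (x : K))‖ < 1)
    (hκ : κ.IsAnticyclotomic) (a : unrIntegers p →+* PadicComplexInt p) (j : ℤ_[p] →+* unrIntegers p)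
    (ha : ∀ x : unrIntegers p, ((a x : PadicComplexInt p) : ℂ_[p]) = (x : ℂ_[p]))
    (hj : ∀ x : ℤ_[p], ((j x : unrIntegers p) : ℂ_[p]) = algebraMap ℚ_[p] ℂ_[p] (x : ℚ_[p])) :
    ∃ (ΩK : ℂ) (Ωp : (unrIntegers p)ˣ) (L : UnrSeries p),
      ΩK ≠ 0 ∧ IsBDPLFunction ι 𝔭 κ γ f ΩK ((Ωp : unrIntegers p) : ℂ_[p]) L ∧
      ∀ m : ℕ, 1 ≤ m →
        ∃ (D : Skinner2016.HidaCongruentMember W p m) (Qm : PowerSeries (PadicComplexInt p)),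
          (∀ x : coeffField D.g, ι (D.ι x) = (x : ℂ)) ∧
          SkinnerUrban2014.IsResiduallyIrreducible D.Δ ∧
          (∀ ℓ : ℕ, ℓ.Prime → ℓ ∣ N / p → ((Ideal.span {(ℓ : ℤ)}).primesOver (𝓞 K)).ncard ≠ 2 →
            (UpperHalfPlane.qExpansion 1 ⇑D.g).coeff ℓ = -((ℓ : ℂ) ^ (D.k / 2 - 1).toNat)) ∧
          IsBDPLFunctionWtSigmaInt ι 𝔭 κ γ D.g (W.sigmaPlacesFinset p K) ΩK ((Ωp : unrIntegers p) : ℂ_[p]) Qm ∧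
          Ideal.span {Qm} ⊔ Ideal.span {(PowerSeries.C (((p : ℕ) : PadicComplexInt p) ^ m))} =
            Ideal.span {PowerSeries.map a (L * PowerSeries.map j (W.sigmaEulerElement p K κ))} ⊔
              Ideal.span {(PowerSeries.C (((p : ℕ) : PadicComplexInt p) ^ m))} :=
  h ι W K 𝔭 κ γ hf hN (by omega) hmult hM hirr hK hodd hβ hsplit h𝔭 hι hκ a j ha hj

/-- **Print-faithful RE-TYPE (vet repair C′) of `castella2020_thm211_members_frames_sigma_congruence_odd`: the same
conjunction of published results read at an odd prime — Castella JIMJ 2020 Def. 2.10 + Thm. 2.11 (odd `p ∤ M`), Skinner 2016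
§2.6/§3.1 (`p ≥ 3`), the `R₀`-frame of `f`, members `g_m` with `ρ̄_{g_m} ≃ E[p]` irreducible, the rigid Steinberg sign at every
`ℓ ∣ M` non-split in `K`, the Σ-imprimitive frames for the SAME CM periods and the congruence (c) — WITH the erratum's printed
hypothesis (iii), first half: "`E` has nonsplit multiplicative reduction at each prime `q ∥ N` which is nonsplit in `K`"
([Castella2018Erratum] Thm. 1.1 (iii); restated verbatim in arXiv:2409.01360 Thm. 1.3 (iii) / Thm. 3.1 (iii), read p. 3 and p. 8),
inserted after `Irr W p` in the tree's erratum spelling `∀ q, Mult W q → #{𝔮 ∣ q} ≠ 2 → ¬ W.HasSplitMultiplicativeReductionAtPrime q`.**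
WHY: the erratum's footnote 1 — "by 'rigidity of automorphic types' [FO12, Lem. 2.14], condition (iii) in Theorem 1.1 implies
conditions (iii) and (iv) in Theorem 2.3" — derives the members' Steinberg sign `a_ℓ(g_m) = −ℓ^{k_m/2−1}` at the non-split `ℓ ∣ M`
FROM (iii); the original decl above omits (iii) and is FALSE as stated (refuter `bsd-vet-utdR2` g0, 2026-08-28, memo
`pub/bsd-wall/bsd-vet-utdR2/VET-UTDR2-g0.md`: for a member, `T_{g_m}/p^m ≃ T_pE/p^m` gives `ε_ℓ(g_m) = a_ℓ(E)·(ℓ/p)^{(k−2)/(p−1)}`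
at `ℓ ∥ M`, so a SPLIT multiplicative `ℓ ∣ M` not split in `K` — e.g. `E = 39a1`, `p = 3`, `K = ℚ(√−143)`, `ℓ = 13` ramified in
`K` — forces `a_ℓ(g_m) = +ℓ^{k/2−1}` for every member and every `m`). Under (iii), `a_ℓ(E) = −1` at these `ℓ` and members of
weight `k = 2 + (p−1)p^{m−1}t` with `t` even carry the printed sign (the vet's parity remark; harmless under `∃` over members).
All binders, the transcription and the flags `MF-odd-p`, `MF-frame-f-at-p|N`, `MF-compat`, `MF-chain`, `MF-sp-factor`,
`MF-receptacle`, `MF-sigma-interp`, `MF-periods`, `MF-own-ring`, `MF-per-m`, `MF-A-side` are those of the original (module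
docstring); the one change is the added hypothesis (a WEAKER `Prop`). The consumer of record (UTD ♭B′ 27401 / support 27933)
instantiates it at an all-split `K` (`SatisfiesHeegnerHypothesis N K`), where (iii) is vacuous. A conjunction of published results
(D-0014); nothing about `p`-adic `L`-functions is constructed here. The original decl is kept (append protocol; dependents are
re-keyed by the route steward), never to be cited.
[cite: Castella2018Erratum, Thm. 1.1 hypothesis (iii) and footnote 1, proof of Thm. 1.1 (a)(b)(c) (p. 4)]
[cite: Castella2020JIMJ, §2 standing (arXiv TeX p. 5: "p an odd prime not dividing N"), Def. 2.10 and Thm. 2.11]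
[cite: Skinner2016PacificMC, §2.6 (2-6-1) and §3.1 (a)(b) (p. 192) (members, `p ≥ 3`)]
[cite: Castella2018, Thm. 3.1, (3.1) (p. 9), (4.1) and p. 11 L9–11 (frame of `f`; `L^Σ`; specialisation — printed for `p > 3`, flag `MF-odd-p`)]
[cite: FouquetOchiai2012, Lem. 2.14 (rigidity of automorphic types for the members, from (iii))]
[cite: JetchevSkinnerWan2017, §5.1 (arXiv:1512.06894 tex p0022 L41–50) (Σ-imprimitive interpolation)] -/
def castella2020_thm211_members_frames_sigma_congruence_odd_nonsplit : Prop :=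
  ∀ {p : ℕ} [Fact p.Prime] (ι : PadicAlgCl p ≃+* ℂ) (W : WeierstrassCurve ℚ) [W.IsElliptic]
    [W.IsGloballyMinimal] (K : Type) [Field K] [NumberField K]
    (𝔭 : HeightOneSpectrum (𝓞 K)) (κ : ZpExtension K p) (γ : absoluteGaloisGroup K)
    [Fact (κ.IsTopGenerator γ)] {N : ℕ} [NeZero N] {f : CuspForm (CongruenceSubgroup.Gamma0 N) 2}
    (_ : IsNewformOf W f),
    -- `E/ℚ` of conductor `N`, multiplicative at the ODD prime `p` ("p an odd prime", Cas20 §2; "p ≥ 3", Ski16), `M = N/p ≥ 3`,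
    -- `E[p]` irreducible
    W.conductorNorm ℤ = N → p ≠ 2 → Mult W p → 3 ≤ N / p → Irr W p →
    -- PRINT HYPOTHESIS (iii) of the erratum's Thm. 1.1 (= arXiv:2409.01360 Thm. 1.3 / Thm. 3.1): "`E` has nonsplit
    -- multiplicative reduction at each prime `q ∥ N` which is nonsplit in `K`" — the tree's erratum spelling
    -- (`erratumThm11_exists_isBDPLFunction_isTorsion_charIdeal_eq_OPEN`); by the erratum's footnote 1 it is the printed
    -- source of the Steinberg-sign conjunct of the conclusion [FO12 L.2.14]; ABSENT from the vet-returned original above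
    (∀ (q : ℕ) [Fact q.Prime], Mult W q → ((Ideal.span {(q : ℤ)}).primesOver (𝓞 K)).ncard ≠ 2 →
      ¬ W.HasSplitMultiplicativeReductionAtPrime q) →
    -- `K` imaginary quadratic, `d_K` odd [Cas20 §2.2], Heegner for `N`, `p = 𝔭𝔭̄` split, `𝔭` via `ι`, `p ∤ h_K` is in the frame
    -- predicates' own standing (tree `IsBDPLFunction`); we keep F3♯'s binder list
    IsImaginaryQuadratic K → Odd (NumberField.discr K) → (∃ β : ℤ, (4 * N : ℤ) ∣ β ^ 2 - NumberField.discr K) →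
    ((Ideal.span {(p : ℤ)}).primesOver (𝓞 K)).ncard = 2 →
    ((p : ℕ) : 𝓞 K) ∈ 𝔭.asIdeal →
    (∀ (w : InfinitePlace K) (x : 𝓞 K), x ∈ 𝔭.asIdeal ↔ ‖ι.symm (w.embedding (x : K))‖ < 1) →
    -- `Γ` THE anticyclotomic `ℤ_p`-extension
    κ.IsAnticyclotomic →
    -- receptacle maps: `a : R₀ ⊆ 𝓞_{ℂ_p}` the inclusion, `j : ℤ_p → R₀` the structure map (characterised)
    ∀ (a : unrIntegers p →+* PadicComplexInt p) (j : ℤ_[p] →+* unrIntegers p),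
      (∀ x : unrIntegers p, ((a x : PadicComplexInt p) : ℂ_[p]) = (x : ℂ_[p])) →
      (∀ x : ℤ_[p], ((j x : unrIntegers p) : ℂ_[p]) = algebraMap ℚ_[p] ℂ_[p] (x : ℚ_[p])) →
    -- THEN: an `R₀`-frame of `f` at `(ι, 𝔭)` …
    ∃ (ΩK : ℂ) (Ωp : (unrIntegers p)ˣ) (L : UnrSeries p),
      ΩK ≠ 0 ∧ IsBDPLFunction ι 𝔭 κ γ f ΩK ((Ωp : unrIntegers p) : ℂ_[p]) L ∧
      -- … and for every `m ≥ 1` a member (a)+(b) with its printed properties and its Σ-imprimitive `p`-adic `L`-function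
      ∀ m : ℕ, 1 ≤ m →
        ∃ (D : Skinner2016.HidaCongruentMember W p m) (Qm : PowerSeries (PadicComplexInt p)),
          -- the member's `p`-adic coefficient embedding IS the fixed `ı_p = ι⁻¹` on `ℚ(g_m) ⊂ ℂ` (flag `MF-compat`)
          (∀ x : coeffField D.g, ι (D.ι x) = (x : ℂ)) ∧
          -- `ρ̄_{g_m} ≃ E[p]` is irreducible
          SkinnerUrban2014.IsResiduallyIrreducible D.Δ ∧
          -- rigidity of automorphic types [FO12 L.2.14]: `π(g_m)_ℓ` special ⊗ (`ℓ ↦ −ℓ^{k_m/2−1}`) at every `ℓ ∣ M` non-split in `K`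
          (∀ ℓ : ℕ, ℓ.Prime → ℓ ∣ N / p → ((Ideal.span {(ℓ : ℤ)}).primesOver (𝓞 K)).ncard ≠ 2 →
            (UpperHalfPlane.qExpansion 1 ⇑D.g).coeff ℓ = -((ℓ : ℂ) ^ (D.k / 2 - 1).toNat)) ∧
          -- `Q_m = L^Σ_p(g_m)`: the Σ-imprimitive frame of `g_m` for the SAME periods [Cas20 Thm. 2.11 (odd `p`), JSW17 §5.1]
          IsBDPLFunctionWtSigmaInt ι 𝔭 κ γ D.g (W.sigmaPlacesFinset p K) ΩK ((Ωp : unrIntegers p) : ℂ_[p]) Qm ∧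
          -- (c): `(L^Σ_p(g_m), p^m) = (L^Σ_p(f), p^m)`, `L^Σ_p(f) = L_p(f)·P_Σ`, read in `𝓞_{ℂ_p}⟦T⟧` (flag `MF-odd-p`)
          Ideal.span {Qm} ⊔ Ideal.span {(PowerSeries.C (((p : ℕ) : PadicComplexInt p) ^ m))} =
            Ideal.span {PowerSeries.map a (L * PowerSeries.map j (W.sigmaEulerElement p K κ))} ⊔
              Ideal.span {(PowerSeries.C (((p : ℕ) : PadicComplexInt p) ^ m))}

/-- **WEIGHT-SHARPENED re-type (†) of `castella2020_thm211_members_frames_sigma_congruence_odd_nonsplit`** (the supply of record of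
UTD item stmt-BirchSwinnertonDyer-22593): the SAME conjunction of published results at an odd prime — Castella JIMJ 2020 Def. 2.10 +
Thm. 2.11, Skinner 2016 §2.6/§3.1, the `R₀`-frame of `f`, members `g_m` with `ρ̄_{g_m} ≃ E[p]` irreducible, the rigid Steinberg sign,
the Σ-imprimitive frames for the same CM periods and the congruence (c), WITH the erratum's hypothesis (iii) — and ONE added conjunct on
the member at each level `m ≥ 1`: its weight lies in the sub-progression `k_m ≡ 2 (mod 2(p−1)p^{m−1})`, i.e. `ε^{(k_m−2)/2} ≡ 1 (mod p^m)`,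
so that the SELF-DUAL Tate twist of its lattice (`OrdinaryNewformDatum.selfDualRep`, the `A_g` of [Castella2018Erratum, §2 p. 2]) satisfies
`A†_{g_m}[p^m] ≃ A_{g_m}[p^m] ≃ (E[p^∞] ⊗ 𝒪_m)[p^m]`. WHY (repair of the lattice normalisation found by refuter `bsd-vet-utdR2` g3 on
UTD K1-at-3, 2026-08-28): the member-tower arguments consume the congruence (b) for the self-dual lattice, which Hida theory supplies
exactly for these weights; the choice is FREE in print — Skinner: "for an integer `k′ > 2` with `k′ ≡ k (mod (p−1)p^c)` … if
`k′ ≡ k (mod (p−1)p^{r_m})` then `φ_{k′} ≡ φ₀ (mod p^m)` … for each `m` we choose such a `k′ = k_m`" (take `k_m ≡ 2` modulo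
`2(p−1)p^{m−1}` as well), and the erratum's proof of Thm. 1.1 (a)(b) uses the self-dual `T_{g_m}` with «`T_{g_m}/p^m T_{g_m} ≃ T/p^m T`»,
which needs precisely this divisibility. Castella's Thm. 2.11 specialises the two-variable `p`-adic `L`-function at EVERY arithmetic weight
of the family, so the frames and the congruence (c) hold for the chosen members verbatim. All binders, the transcription and the flags are
those of `…_odd_nonsplit` (module docstring); the one change is the added conjunct (a STRONGER conclusion; `…_odd_nonsplit_of_wt` is the
projection). A conjunction of published results (D-0014); nothing about `p`-adic `L`-functions is constructed here.
[cite: Skinner2016PacificMC, §2.6 (2-6-1) (arXiv:1407.1093 p. 12: choice of `k_m`) and §3.1 (a)(b) (p. 192)]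
[cite: Castella2018Erratum, §2 (p. 2: the self-dual Tate twist), Thm. 1.1 hypothesis (iii) and footnote 1, proof of Thm. 1.1 (a)(b)(c) (p. 4)]
[cite: Castella2020JIMJ, §2 standing (arXiv TeX p. 5: "p an odd prime not dividing N"), Def. 2.10 and Thm. 2.11]
[cite: Castella2018, Thm. 3.1, (3.1) (p. 9), (4.1) and p. 11 L9–11]
[cite: FouquetOchiai2012, Lem. 2.14 (rigidity of automorphic types for the members, from (iii))]
[cite: JetchevSkinnerWan2017, §5.1 (arXiv:1512.06894 tex p0022 L41–50) (Σ-imprimitive interpolation)] -/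
def castella2020_thm211_members_frames_sigma_congruence_odd_nonsplit_wt : Prop :=
  ∀ {p : ℕ} [Fact p.Prime] (ι : PadicAlgCl p ≃+* ℂ) (W : WeierstrassCurve ℚ) [W.IsElliptic]
    [W.IsGloballyMinimal] (K : Type) [Field K] [NumberField K]
    (𝔭 : HeightOneSpectrum (𝓞 K)) (κ : ZpExtension K p) (γ : absoluteGaloisGroup K)
    [Fact (κ.IsTopGenerator γ)] {N : ℕ} [NeZero N] {f : CuspForm (CongruenceSubgroup.Gamma0 N) 2}
    (_ : IsNewformOf W f),
    -- `E/ℚ` of conductor `N`, multiplicative at the ODD prime `p` ("p an odd prime", Cas20 §2; "p ≥ 3", Ski16), `M = N/p ≥ 3`,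
    -- `E[p]` irreducible
    W.conductorNorm ℤ = N → p ≠ 2 → Mult W p → 3 ≤ N / p → Irr W p →
    -- PRINT HYPOTHESIS (iii) of the erratum's Thm. 1.1 (= arXiv:2409.01360 Thm. 1.3 / Thm. 3.1): "`E` has nonsplit
    -- multiplicative reduction at each prime `q ∥ N` which is nonsplit in `K`" — the tree's erratum spelling
    -- (`erratumThm11_exists_isBDPLFunction_isTorsion_charIdeal_eq_OPEN`); by the erratum's footnote 1 it is the printed
    -- source of the Steinberg-sign conjunct of the conclusion [FO12 L.2.14]; ABSENT from the vet-returned original above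
    (∀ (q : ℕ) [Fact q.Prime], Mult W q → ((Ideal.span {(q : ℤ)}).primesOver (𝓞 K)).ncard ≠ 2 →
      ¬ W.HasSplitMultiplicativeReductionAtPrime q) →
    -- `K` imaginary quadratic, `d_K` odd [Cas20 §2.2], Heegner for `N`, `p = 𝔭𝔭̄` split, `𝔭` via `ι`, `p ∤ h_K` is in the frame
    -- predicates' own standing (tree `IsBDPLFunction`); we keep F3♯'s binder list
    IsImaginaryQuadratic K → Odd (NumberField.discr K) → (∃ β : ℤ, (4 * N : ℤ) ∣ β ^ 2 - NumberField.discr K) →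
    ((Ideal.span {(p : ℤ)}).primesOver (𝓞 K)).ncard = 2 →
    ((p : ℕ) : 𝓞 K) ∈ 𝔭.asIdeal →
    (∀ (w : InfinitePlace K) (x : 𝓞 K), x ∈ 𝔭.asIdeal ↔ ‖ι.symm (w.embedding (x : K))‖ < 1) →
    -- `Γ` THE anticyclotomic `ℤ_p`-extension
    κ.IsAnticyclotomic →
    -- receptacle maps: `a : R₀ ⊆ 𝓞_{ℂ_p}` the inclusion, `j : ℤ_p → R₀` the structure map (characterised)
    ∀ (a : unrIntegers p →+* PadicComplexInt p) (j : ℤ_[p] →+* unrIntegers p),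
      (∀ x : unrIntegers p, ((a x : PadicComplexInt p) : ℂ_[p]) = (x : ℂ_[p])) →
      (∀ x : ℤ_[p], ((j x : unrIntegers p) : ℂ_[p]) = algebraMap ℚ_[p] ℂ_[p] (x : ℚ_[p])) →
    -- THEN: an `R₀`-frame of `f` at `(ι, 𝔭)` …
    ∃ (ΩK : ℂ) (Ωp : (unrIntegers p)ˣ) (L : UnrSeries p),
      ΩK ≠ 0 ∧ IsBDPLFunction ι 𝔭 κ γ f ΩK ((Ωp : unrIntegers p) : ℂ_[p]) L ∧
      -- … and for every `m ≥ 1` a member (a)+(b) with its printed properties and its Σ-imprimitive `p`-adic `L`-function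
      ∀ m : ℕ, 1 ≤ m →
        ∃ (D : Skinner2016.HidaCongruentMember W p m) (Qm : PowerSeries (PadicComplexInt p)),
          -- WEIGHT CLAUSE (†): `k_m ≡ 2 (mod 2(p−1)p^{m−1})`, i.e. `ε^{(k_m−2)/2} ≡ 1 (mod p^m)`, so that the SELF-DUAL
          -- lattice satisfies `A_{g_m}†[p^m] ≃ A_{g_m}[p^m] ≃ E[p^m]` — a free choice of the member's weight in print
          -- [Skinner2016PacificMC §2.6: "if k′ ≡ k (mod (p−1)p^{r_m}) then φ_{k′} ≡ φ₀ (mod p^m) … we choose such a k′ = k_m";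
          --  Castella2018Erratum, proof of Thm. 1.1 (a)(b): self-dual `T_{g_m}`]
          (2 * ((p : ℤ) - 1) * (p : ℤ) ^ (m - 1)) ∣ D.k - 2 ∧
          -- the member's `p`-adic coefficient embedding IS the fixed `ı_p = ι⁻¹` on `ℚ(g_m) ⊂ ℂ` (flag `MF-compat`)
          (∀ x : coeffField D.g, ι (D.ι x) = (x : ℂ)) ∧
          -- `ρ̄_{g_m} ≃ E[p]` is irreducible
          SkinnerUrban2014.IsResiduallyIrreducible D.Δ ∧
          -- rigidity of automorphic types [FO12 L.2.14]: `π(g_m)_ℓ` special ⊗ (`ℓ ↦ −ℓ^{k_m/2−1}`) at every `ℓ ∣ M` non-split in `K`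
          (∀ ℓ : ℕ, ℓ.Prime → ℓ ∣ N / p → ((Ideal.span {(ℓ : ℤ)}).primesOver (𝓞 K)).ncard ≠ 2 →
            (UpperHalfPlane.qExpansion 1 ⇑D.g).coeff ℓ = -((ℓ : ℂ) ^ (D.k / 2 - 1).toNat)) ∧
          -- `Q_m = L^Σ_p(g_m)`: the Σ-imprimitive frame of `g_m` for the SAME periods [Cas20 Thm. 2.11 (odd `p`), JSW17 §5.1]
          IsBDPLFunctionWtSigmaInt ι 𝔭 κ γ D.g (W.sigmaPlacesFinset p K) ΩK ((Ωp : unrIntegers p) : ℂ_[p]) Qm ∧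
          -- (c): `(L^Σ_p(g_m), p^m) = (L^Σ_p(f), p^m)`, `L^Σ_p(f) = L_p(f)·P_Σ`, read in `𝓞_{ℂ_p}⟦T⟧` (flag `MF-odd-p`)
          Ideal.span {Qm} ⊔ Ideal.span {(PowerSeries.C (((p : ℕ) : PadicComplexInt p) ^ m))} =
            Ideal.span {PowerSeries.map a (L * PowerSeries.map j (W.sigmaEulerElement p K κ))} ⊔
              Ideal.span {(PowerSeries.C (((p : ℕ) : PadicComplexInt p) ^ m))}

/-- **Projection**: the weight-sharpened supply `…_odd_nonsplit_wt` implies the supply of record `…_odd_nonsplit` (drop the weight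
conjunct). Bookkeeping, proved. [cite: Skinner2016PacificMC, §2.6 (2-6-1)] [cite: Castella2018Erratum, proof of Thm. 1.1 (a)(b) (p. 4)] -/
theorem castella2020_thm211_members_frames_sigma_congruence_odd_nonsplit_of_wt
    (h : castella2020_thm211_members_frames_sigma_congruence_odd_nonsplit_wt) :
    castella2020_thm211_members_frames_sigma_congruence_odd_nonsplit := by
  intro p _ ι W _ _ K _ _ 𝔭 κ γ _ N _ f hf hN hp hM h3 hIrr hns hK hodd hH hsplit h𝔭 hw hκ a j ha hj
  obtain ⟨ΩK, Ωp, L, hΩ, hL, hm⟩ := h ι W K 𝔭 κ γ hf hN hp hM h3 hIrr hns hK hodd hH hsplit h𝔭 hw hκ a j ha hj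
  refine ⟨ΩK, Ωp, L, hΩ, hL, fun m hm1 => ?_⟩
  obtain ⟨D, Qm, -, h1, h2, h3', h4, h5⟩ := hm m hm1
  exact ⟨D, Qm, h1, h2, h3', h4, h5⟩

end Literature.NumberTheory.EllipticCurves.Castella2018

end
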